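import Summits.SmoothPoincare4.SmoothPoincare4.Theorems.SymplecticOrigamiGromovRecognitionRelEndGlueData
import Summits.SmoothPoincare4.SmoothPoincare4.Theorems.SymplecticOrigamiGromovRecognitionRelEndClassCount
import Summits.SmoothPoincare4.SmoothPoincare4.Theorems.SymplecticOrigamiGromovRecognitionRelEndLeafDisjoint
import Literature.Geometry.Symplectic.JSphereLocalFoliation
import Literature.Geometry.Symplectic.JCurveIntersectionCountHomological

/-!
# A `V`-leaf is never contained in an `H`-leaf
(registered helper `helper_noLocalInclusion` of line `cross-cap-laurent`, crux
`GromovRecognitionRelEnd`, item stmt-SmoothPoincare4-11009; integration lemma J14 of the glue of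
the bi-foliation)

Setting: the data `D : FoliationData ωX JX u₀ v₀ uH vH F₀ TH TV UH UV δ` of the `V`-fibration of
the wedge cap (reference sphere `V∞ = (u₀, v₀)` with glued map `F₀`, transverse wedge sphere
`H∞ = (uH, vH)`, holomorphic wedge coordinate `TH` on `UH` with zero set `H∞`) AND the data
`D' : FoliationData ωX JX uH vH u₀ v₀ FH TV TH UV UH δ` of the `H`-fibration (roles exchanged:
reference sphere `H∞` with glued map `FH`).  A `V`-leaf is `IsLeafOf (fun y => JX y) F₀ u v`, an
`H`-leaf is `IsLeafOf (fun y => JX y) FH u' v'`.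

Claim: the image `pairImage u v` of a `V`-leaf is never contained in the image `pairImage u' v'`
of an `H`-leaf.

Proof: suppose `pairImage u v ⊆ pairImage u' v'`.  By `helper_leaf_meetsOnce` (with the fact
`jSphere_wedgeCount_factorsThroughHomology`, a hypothesis) the `V`-leaf meets the zero set
`{y ∈ UH | TH y = 0} = H∞` at exactly one parameter: either at a unique affine parameter `z₀`
(and not at `v 0`), or nowhere in the affine chart and at `v 0`.  In both cases a point `p` of the
`V`-leaf lies on `H∞`, hence on the `H`-leaf `(u', v')` too; but `H∞` is itself an `H`-leaf
(`helper_leaf_ref` for `D'`) and two `H`-leaves are equal or disjoint (`helper_leaf_disjoint`,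
with the local foliation fact `hls_localFoliation_embeddedSphere_trivialNormal`, a hypothesis), so
`pairImage u' v' = H∞` and the WHOLE `V`-leaf lies on `H∞`, i.e. in the zero set: in the first
case the uniqueness of the meeting parameter forces `z₀ + 1 = z₀`, in the second case `u 0` is an
affine meeting point — a contradiction either way.

References: M. Gromov, Invent. Math. 82 (1985), §2.4; D. McDuff, J. Amer. Math. Soc. 3 (1990), §3
(the two transverse foliations of the cap).  No new definitions, notation or instances.
-/

noncomputable section

open scoped Manifold ContDiff Topology
open Set Function Filter Literature.Topology.FourManifolds Literature.Topology.FourManifolds.ComplexProjectiveSpace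
  Literature.Geometry.Kaehler Literature.Geometry.Symplectic Literature.AlgebraicTopology.SingularHomology

-- the prescribed namespace `Summit.<P>.<Sub>.…` duplicates `SmoothPoincare4` (P = Sub)
set_option linter.dupNamespace false

namespace Summit.SmoothPoincare4.SmoothPoincare4.Theorems.GromovRecognitionRelEnd.CrossCapLaurent

/-- **J14 (registered helper `helper_noLocalInclusion`): a `V`-leaf is never contained in an
`H`-leaf.**  The `V`-leaf `(u, v)` meets the transverse wedge sphere `H∞ = {y ∈ UH | TH y = 0}`
at exactly one parameter (`helper_leaf_meetsOnce`); `H∞` is an `H`-leaf (`helper_leaf_ref` for the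
`H`-fibration data) and distinct `H`-leaves are disjoint (`helper_leaf_disjoint`), so an `H`-leaf
containing the `V`-leaf would be `H∞` itself and would contain every point of the `V`-leaf,
contradicting the uniqueness (resp. absence) of the affine meeting parameter. -/
theorem helper_noLocalInclusion : ∀ (X : Type) [TopologicalSpace X] [T2Space X]
    [SecondCountableTopology X] [CompactSpace X] [ConnectedSpace X]
    [ChartedSpace (EuclideanSpace ℝ (Fin 4)) X] [IsManifold (𝓡 4) ∞ X] (ωX : MForm (𝓡 4) X ℝ 2)
    (JX : AlmostComplexStructure (𝓡 4) ∞ X) (u₀ v₀ uH vH : ℂ → X)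
    (F₀ FH : C(ComplexProjectiveSpace 1, X)) (TH TV : X → ℂ) (UH UV : Set X) (δ : ℝ),
    hls_localFoliation_embeddedSphere_trivialNormal → jSphere_wedgeCount_factorsThroughHomology →
    FoliationData ωX JX u₀ v₀ uH vH F₀ TH TV UH UV δ →
    FoliationData ωX JX uH vH u₀ v₀ FH TV TH UV UH δ →
    ∀ (u v u' v' : ℂ → X), IsLeafOf (fun y => JX y) F₀ u v → IsLeafOf (fun y => JX y) FH u' v' →
    ¬ (pairImage u v ⊆ pairImage u' v') := by
  intro X _ _ _ _ _ _ _ ωX JX u₀ v₀ uH vH F₀ FH TH TV UH UV δ hF1 hF6 D D' u v u' v' hleaf hleaf'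
    hsub
  -- `H∞ = (uH, vH)` is an `H`-leaf
  have hrefH : IsLeafOf (fun y => JX y) FH uH vH :=
    helper_leaf_ref X ωX JX uH vH u₀ v₀ FH TV TH UV UH δ D'
  -- the zero set of `TH` on `UH` is `H∞`
  have hzs : ∀ y : X, (y ∈ UH ∧ TH y = 0) ↔ y ∈ pairImage uH vH := fun y =>
    Set.ext_iff.mp D.zeroSetH y
  -- if the `V`-leaf touches `H∞` at a point `p`, the `H`-leaf `(u', v')` IS `H∞`
  have key : ∀ p : X, p ∈ pairImage u v → p ∈ pairImage uH vH →
      pairImage u' v' = pairImage uH vH := fun p hp hpH => by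
    rcases helper_leaf_disjoint X JX FH hF1 u' v' uH vH hleaf' hrefH with h | h
    · exact h
    · exact (Set.disjoint_left.mp h (hsub hp) hpH).elim
  rcases helper_leaf_meetsOnce X ωX JX u₀ v₀ uH vH F₀ TH TV UH UV δ hF6 D u v hleaf with
    ⟨z₀, hz₀, huniq, -, -⟩ | ⟨hnone, hv0, -⟩
  · -- the meeting point is `u z₀`: then every `u z` is a meeting point, e.g. `u (z₀ + 1)`
    have hp : u z₀ ∈ pairImage u v := (mem_pairImage_iff u v _).mpr (Or.inl ⟨z₀, rfl⟩)
    have heq : pairImage u' v' = pairImage uH vH := key (u z₀) hp ((hzs _).mp hz₀)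
    have h1 : u (z₀ + 1) ∈ pairImage uH vH := by
      rw [← heq]
      exact hsub ((mem_pairImage_iff u v _).mpr (Or.inl ⟨z₀ + 1, rfl⟩))
    exact one_ne_zero (add_eq_left.mp (huniq (z₀ + 1) ((hzs _).mpr h1)))
  · -- the meeting point is `v 0`: then `u 0` is an affine meeting point
    have hp : v 0 ∈ pairImage u v := (mem_pairImage_iff u v _).mpr (Or.inr rfl)
    have heq : pairImage u' v' = pairImage uH vH := key (v 0) hp ((hzs _).mp hv0)
    have h1 : u 0 ∈ pairImage uH vH := by
      rw [← heq]
      exact hsub ((mem_pairImage_iff u v _).mpr (Or.inl ⟨0, rfl⟩))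
    exact hnone 0 ((hzs _).mpr h1)

end Summit.SmoothPoincare4.SmoothPoincare4.Theorems.GromovRecognitionRelEnd.CrossCapLaurent

end
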